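import Summits.QuantumFields.BalabanUV.T4Continuum.Support.ShellMeasureWilsonGaugeInvariant
import Summits.QuantumFields.BalabanUV.T4Continuum.Support.ShellMeasureThresholdUnits

/-!
# `T4Continuum.ShellMeasureLiveEndOneCallGibbs` — row S92 f1b «THE GIBBS SLOTS OF THE ONE CALL»: END-I's (M1) binder for
# the live slots at LATTICE LEVEL 0 (the pure Wilson Gibbs face), in the γ8 threshold units, as a `(r, K, t, s)`-indexed
# family in the conventions of S92 file 1 — the level-0 supplier of record (S1) composed with the unit change (S90)
(cell `pub-balaban`, sub-cell `t4`, spine estimate NE7c (node U5b); NE7c ROUND-2 crew `t4-ne7c-formalise-*`, unit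
`b2b-balaban-t4-ne7c-formalise-leaf-06` gen 7 (the S19 lineage); owner table `t4/b2b-balaban-t4-ne7c-p1/LEAVES-NE7c-P1.md`
row **S92** (holder leaf-09-g12: file 1 `ShellMeasureLiveEndOneCallSlot.hac_live_of_assembled_decay` = the background-mediated
slots through S80 f3, p231081; file 2 `ShellMeasureLiveEndOneCall`; the union file 3), this file = **S92 f1b** by the
owner's ruling R-ne7cp1-g33-5 (b) on journal «Q NE7c-S92» (Q4) and the holder's GO; ADDITIVE — imports S1
`ShellMeasureWilsonGaugeInvariant` (p207446) and S90 `ShellMeasureThresholdUnits` (p229839) ONLY, both BY NAME; [folklore];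
0 `def`, 0 `def … : Prop`, 0 sorry, 0 citation tags)

HONEST FRAMING.  Finite four-torus programme, rung (B)+1 only — NOT infinite volume, NOT a mass gap, NOT the Clay
problem, NOT summit progress; (B), `BetaPertHyp`, (B^μ) not consumed.  NE7c (`T4IndicatorShell.ShellWeightBound`) is NOT
PRINTED in [Balaban 1983–89] and NOT PROVED; «NE7c ⇐ the named binders» (trigger c3); (M1)₀ realized ≠ NE7c.  Nothing
printed is asserted ([Balaban1988Convergent] (2.17)∕(2.18) at `k = 0` LOCATE the shape «the level-0 slot's realized law is
the Wilson Gibbs face with tested variable the plaquette classifier» — not a citation for a step); no estimate of Bałaban's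
is discharged.  HONEST DEPENDENCY (cell): continuum YM on T⁴ ⇐ BetaPertH ∧ nine spine estimates (0/9 proved); BetaPertH ⇐
(D1) ∧ (D4) ∧ CAP+tail; G-an2-4 gates asym, D1 and NE2/3/4.

THE POINT.  END-I of record (S27 `ShellMeasureRootCompositionSync.shellWeightBound_of_schemeData_age` ∕ `…_towerData_sync`)
displays ONE (M1) binder `hacA` over ALL live slots of run A.  In the window's OLDEST comparisons `K ≤ N₁` run A carries live
slots at lattice level `jl = 0` — the bare Wilson step, no background: their realized law is the GIBBS face
`(fieldMeasure P 0 SU2).withDensity (giF lo hi σ β P_w)` with tested variable `wilsonU`, for which the supplier of record is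
S1 `ShellMeasureWilsonGaugeInvariant.slotAntiConcentration_wilson_su2_gaugeInvariant` — box geometry + numbers + (SM)₀, NO
scheme tuple, NO dictionary binder, NO decay data (WALL-NE7c-P1 §1 «LEVEL-0 FACE», §3 «at level 0 … as is», §6 «the
level-0 face serves `K ≤ N₁` only»; owner R-ne7cp1-g33-5 (b)).  Run B never meets these slots (its paired slot sits one
lattice level up; `S₀ false K = ∅` in the union).  S92 file 1 routes the background-mediated slots `S₁ r K` through S80 f3;
THIS FILE supplies the Gibbs slots `S₀ r K` in the SAME currency — run index `r : Bool` first, slot lattice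
`(P r K s, jl r K s)`, profiles `ε η ρ β : Bool → ℕ → ℝ` read as `ε r (K − lvl r K s)`, `η r (jl r K s)`,
`ρ r (lvl r K s)`, `β r (jl r K s)`, box data by `(r, K, s)`, the numbers `S δ` SHARED, hypotheses unguarded, the
conclusion `t`-constant and stated `∀ r K (t : ℝ) s` — so that file 3 takes `S r K := S₀ r K ∪ S₁ r K` and assembles
`hacA`∕`hacB` by `Finset.mem_union` cases:
* §1 `slotAC_gibbs_thresholdUnits` — ONE Gibbs slot: S1 at the fine threshold `θ := εθ·η²` ∘ S90
  `slotAntiConcentration_thresholdUnits`; `…_le` — at any displayed majorant (`T4ShellMeasureFibre.slotAntiConcentration_mono`).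
* §2 **`hac_gibbs_of_face`** — THE INDEXED FAMILY FORM, constant WRITTEN OUT
  `D₀ r K s = 2(m₀ r K s + β r (jl r K s)·Σ_{p ∈ Pw r K s}(8S)(8 + 32S))∕(1−δ)`; **`hac_gibbs_of_face_le`** — at a displayed
  level majorant `D r (lvl r K s)` (file 2's `hDslot` row); **`hac_gibbs_of_identified`** — for ONE density family
  `F r K t s` and ONE variable family `u r K t s` IDENTIFIED with the Gibbs face ∕ the Wilson classifier on the Gibbs slots
  `s ∈ S₀ r K` (guarded form, for a consumer that keeps single families over `S₀ ∪ S₁`).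
* §3 consistency `example` (the unit change on S1's conclusion shape); (x1) by pointer — no new geometric family: the box
  family is S1's, jointly inhabited with a NONEMPTY block, (M1)₀ fired and a live shell of POSITIVE realized mass by
  leaf-10-g11's S89 f1–f4 (`ShellMeasureLevelZeroBoxWitness.levelZero_face_su2_inhabited`,
  `ShellMeasureLevelZeroShellMass.shellMass_pos`; not imported — cone kept at S1 + S90).
NOT HERE: which slots are Gibbs slots ((W1)∕`LiveWindow` bookkeeping: those with `jl = 0`, live for `K ≤ N₁`); (MR)₀
(S2∕S22∕S38); the union END (file 3, leaf-09-g12); anything of Bałaban's.  NOTHING in the countdown moves; NE7c NOT PROVED;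
spine PROVED 0∕9.
-/

noncomputable section

open Set MeasureTheory

namespace Summit.QuantumFields.BalabanUV.T4Continuum.ShellMeasureLiveEndOneCallGibbs

open scoped ENNReal
open Literature.MathematicalPhysics.QuantumFieldTheory.Balaban1983to89
open T4ShellMeasure (SlotAntiConcentration)
open T4ShellMeasureFibre (slotAntiConcentration_mono)
open T4CubeChartGnomonic (SU2)
open T4AxialGaugeFixing (combBonds)
open T4AxialGaugeSmallField (boxPlaqs boxBonds)
open ShellMeasureWilsonRealizedSU2 (wilsonU)
open ShellMeasureWilsonGaugeInvariant (giF slotAntiConcentration_wilson_su2_gaugeInvariant)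
open ShellMeasureThresholdUnits (slotAntiConcentration_thresholdUnits slotAntiConcentration_fine_iff)

/-! ## §1 ONE Gibbs slot in threshold units -/

section OneSlot

variable {P : Params} {j : ℕ} [DecidableEq (PBond P j)]

/-- **(M1)₀ FOR THE GIBBS FACE IN THRESHOLD UNITS.**  S1's level-0 face at the FINE threshold `θ := εθ·η²` (`η > 0` the
slot's scale, `εθ > 0` its age threshold), transported by the γ8 unit change: (M1) for the η²-NORMALISED classifier
`wilsonU ∕ η²` at `εθ`, same width `ρ`, same constant `2(m₀ + β·Σ_{P_w}(8S)(8 + 32S))∕(1−δ)`.  Binders = S1's verbatim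
(non-wrapping box of side `≤ mb`, chart bonds = box bonds off the axial comb with an enumeration of the `m₀ = 3·#Λ`
coordinates, reach `(d−1)·mb·σ ≤ 2S∕π`, `∅ ≠ P_u ⊆ boxPlaqs`, numbers) with (SM)₀ displayed at the fine threshold. [folklore] -/
theorem slotAC_gibbs_thresholdUnits
    {lo hi : Fin P.d → ℤ} {mb : ℕ} (hN : ∀ κ, hi κ - lo κ < P.sitesPerDir j) (hm : ∀ κ, hi κ ≤ lo κ + mb)
    (Λ : Finset (PBond P j)) (hΛbox : ∀ b ∈ Λ, b ∈ boxBonds lo hi)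
    (hΛcomb : Disjoint Λ (combBonds lo hi))
    (hcov : ∀ b ∈ boxBonds lo hi, b ∉ Λ → b ∈ (combBonds lo hi : Finset (PBond P j)))
    {m₀ : ℕ} (e : ↥Λ × Fin 3 ≃ Fin m₀)
    {S σc : ℝ} (hS : 0 < S) (hS8 : S ≤ 1 / 8) (hSπ : 3 * S ^ 2 < Real.pi ^ 2) (hσ : 0 < σc)
    (hrad : ((P.d - 1 : ℕ) : ℝ) * mb * σc ≤ 2 * S / Real.pi)
    {Pu : Finset (Plaq P j)} (hPu : Pu.Nonempty) (hPubox : ∀ p ∈ Pu, p ∈ boxPlaqs lo hi)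
    (Pw : Finset (Plaq P j)) {β εθ η δ ρ : ℝ} (hβ : 0 ≤ β) (hεθ : 0 < εθ) (hη : 0 < η) (hδ0 : 0 ≤ δ) (hδ1 : δ < 1)
    (hρ0 : 0 ≤ ρ) (hρ : ρ ≤ (1 - δ) / 2)
    (hSM : 4 * (8 * S) ^ 2 * Real.exp (2 * (8 * S)) ≤ δ * (εθ * η ^ 2))
    (hSMσ : 4 * (8 * S) ^ 2 * Real.exp (2 * (8 * S)) ≤ δ * σc) :
    SlotAntiConcentration ((fieldMeasure P j SU2).withDensity (giF lo hi σc β Pw)) (fun U => wilsonU hPu U / η ^ 2) εθ ρ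
      (2 * ((m₀ : ℝ) + β * ∑ _p ∈ Pw, (8 * S) * (8 + 4 * (8 * S))) / (1 - δ)) :=
  slotAntiConcentration_thresholdUnits hη
    (slotAntiConcentration_wilson_su2_gaugeInvariant hN hm Λ hΛbox hΛcomb hcov e hS hS8 hSπ hσ hrad hPu hPubox Pw hβ
      (mul_pos hεθ (pow_pos hη 2)) hδ0 hδ1 hρ0 hρ hSM hSMσ)

/-- … at any DISPLAYED majorant `D′` of the constant (END-I's `hDslot` ∕ `D ≤ D̄` bookkeeping). [folklore] -/
theorem slotAC_gibbs_thresholdUnits_le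
    {lo hi : Fin P.d → ℤ} {mb : ℕ} (hN : ∀ κ, hi κ - lo κ < P.sitesPerDir j) (hm : ∀ κ, hi κ ≤ lo κ + mb)
    (Λ : Finset (PBond P j)) (hΛbox : ∀ b ∈ Λ, b ∈ boxBonds lo hi)
    (hΛcomb : Disjoint Λ (combBonds lo hi))
    (hcov : ∀ b ∈ boxBonds lo hi, b ∉ Λ → b ∈ (combBonds lo hi : Finset (PBond P j)))
    {m₀ : ℕ} (e : ↥Λ × Fin 3 ≃ Fin m₀)
    {S σc : ℝ} (hS : 0 < S) (hS8 : S ≤ 1 / 8) (hSπ : 3 * S ^ 2 < Real.pi ^ 2) (hσ : 0 < σc)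
    (hrad : ((P.d - 1 : ℕ) : ℝ) * mb * σc ≤ 2 * S / Real.pi)
    {Pu : Finset (Plaq P j)} (hPu : Pu.Nonempty) (hPubox : ∀ p ∈ Pu, p ∈ boxPlaqs lo hi)
    (Pw : Finset (Plaq P j)) {β εθ η δ ρ : ℝ} (hβ : 0 ≤ β) (hεθ : 0 < εθ) (hη : 0 < η) (hδ0 : 0 ≤ δ) (hδ1 : δ < 1)
    (hρ0 : 0 ≤ ρ) (hρ : ρ ≤ (1 - δ) / 2)
    (hSM : 4 * (8 * S) ^ 2 * Real.exp (2 * (8 * S)) ≤ δ * (εθ * η ^ 2))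
    (hSMσ : 4 * (8 * S) ^ 2 * Real.exp (2 * (8 * S)) ≤ δ * σc)
    {D' : ℝ} (hD' : 2 * ((m₀ : ℝ) + β * ∑ _p ∈ Pw, (8 * S) * (8 + 4 * (8 * S))) / (1 - δ) ≤ D') :
    SlotAntiConcentration ((fieldMeasure P j SU2).withDensity (giF lo hi σc β Pw)) (fun U => wilsonU hPu U / η ^ 2) εθ ρ
      D' :=
  slotAntiConcentration_mono hρ0 hD'
    (slotAC_gibbs_thresholdUnits hN hm Λ hΛbox hΛcomb hcov e hS hS8 hSπ hσ hrad hPu hPubox Pw hβ hεθ hη hδ0 hδ1 hρ0 hρ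
      hSM hSMσ)

end OneSlot

/-! ## §2 The `(r, K, t, s)`-indexed family form END-I consumes (S92 file-1 conventions) -/

section Family

variable {σ : Type*}

/-- **END-I's (M1) BINDER FOR THE GIBBS SLOTS — INDEXED, THRESHOLD UNITS, CONSTANT WRITTEN OUT** (S92 file-1 currency:
run `r : Bool`, slot lattice `(P r K s, jl r K s)`, profiles `ε η ρ β : Bool → ℕ → ℝ`, numbers `S δ` shared, hypotheses
unguarded, conclusion `t`-constant).  For every `r K t s`: (M1) for the realized level-`jl r K s` Gibbs face of the slot's
box under the η²-normalised classifier at the AGE threshold `ε r (K − lvl r K s)`, width `ρ r (lvl r K s)`, constant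
`D₀ r K s = 2(m₀ r K s + β r (jl r K s)·Σ_{p∈Pw r K s}(8S)(8 + 32S))∕(1−δ)`.  Binders per slot: S1's box family
(non-wrapping box of side `≤ mb r K s`, chart bonds `Λ r K s` = the box bonds off the axial comb with an enumeration of
the `m₀ r K s` coordinates, `∅ ≠ P_u ⊆ boxPlaqs`, co-test threshold `σc r K s > 0` with reach `(d−1)·mb·σc ≤ 2S∕π`),
numbers (`0 < S ≤ 1∕8`, `3S² < π²`, `0 ≤ δ < 1`, `ε > 0`, `η > 0`, `0 ≤ ρ ≤ (1−δ)∕2`, `β ≥ 0`), and (SM)₀ DISPLAYED at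
the fine threshold `δ·(ε r (K − lvl r K s)·η r (jl r K s)²)` and at the co-test threshold `δ·σc r K s`.  ONE call of §1
per index; idle indices are inhabited by copying a live Gibbs slot's box data. [folklore] -/
theorem hac_gibbs_of_face
    (P : Bool → ℕ → σ → Params) (jl lvl : Bool → ℕ → σ → ℕ) [∀ r K s, DecidableEq (PBond (P r K s) (jl r K s))]
    {ε η ρ β : Bool → ℕ → ℝ} (hη : ∀ r j, 0 < η r j) (hε : ∀ r a, 0 < ε r a) (hρ0 : ∀ r j, 0 ≤ ρ r j)
    (lo hi : ∀ r K s, Fin (P r K s).d → ℤ) {mb : Bool → ℕ → σ → ℕ}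
    (hN : ∀ r K s κ, hi r K s κ - lo r K s κ < (P r K s).sitesPerDir (jl r K s))
    (hm : ∀ r K s κ, hi r K s κ ≤ lo r K s κ + mb r K s)
    (Λ : ∀ r K s, Finset (PBond (P r K s) (jl r K s)))
    (hΛbox : ∀ r K s, ∀ b ∈ Λ r K s, b ∈ boxBonds (lo r K s) (hi r K s))
    (hΛcomb : ∀ r K s, Disjoint (Λ r K s) (combBonds (lo r K s) (hi r K s)))
    (hcov : ∀ r K s, ∀ b ∈ boxBonds (lo r K s) (hi r K s), b ∉ Λ r K s →
      b ∈ (combBonds (lo r K s) (hi r K s) : Finset (PBond (P r K s) (jl r K s))))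
    {m₀ : Bool → ℕ → σ → ℕ} (e : ∀ r K s, ↥(Λ r K s) × Fin 3 ≃ Fin (m₀ r K s))
    {S : ℝ} (hS : 0 < S) (hS8 : S ≤ 1 / 8) (hSπ : 3 * S ^ 2 < Real.pi ^ 2)
    {σc : Bool → ℕ → σ → ℝ} (hσ : ∀ r K s, 0 < σc r K s)
    (hrad : ∀ r K s, (((P r K s).d - 1 : ℕ) : ℝ) * mb r K s * σc r K s ≤ 2 * S / Real.pi)
    {Pu : ∀ r K s, Finset (Plaq (P r K s) (jl r K s))} (hPu : ∀ r K s, (Pu r K s).Nonempty)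
    (hPubox : ∀ r K s, ∀ p ∈ Pu r K s, p ∈ boxPlaqs (lo r K s) (hi r K s))
    (Pw : ∀ r K s, Finset (Plaq (P r K s) (jl r K s))) {δ : ℝ} (hδ0 : 0 ≤ δ) (hδ1 : δ < 1)
    (hρ : ∀ r j, ρ r j ≤ (1 - δ) / 2) (hβ : ∀ r j, 0 ≤ β r j)
    (hSM : ∀ r K s, 4 * (8 * S) ^ 2 * Real.exp (2 * (8 * S)) ≤ δ * (ε r (K - lvl r K s) * η r (jl r K s) ^ 2))
    (hSMσ : ∀ r K s, 4 * (8 * S) ^ 2 * Real.exp (2 * (8 * S)) ≤ δ * σc r K s) :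
    ∀ (r : Bool) (K : ℕ) (t : ℝ) (s : σ),
      SlotAntiConcentration
        ((fieldMeasure (P r K s) (jl r K s) SU2).withDensity
          (giF (lo r K s) (hi r K s) (σc r K s) (β r (jl r K s)) (Pw r K s)))
        (fun U => wilsonU (hPu r K s) U / η r (jl r K s) ^ 2) (ε r (K - lvl r K s)) (ρ r (lvl r K s))
        (2 * ((m₀ r K s : ℝ) + β r (jl r K s) * ∑ _p ∈ Pw r K s, (8 * S) * (8 + 4 * (8 * S))) / (1 - δ)) :=
  fun r K _ s =>
    slotAC_gibbs_thresholdUnits (hN r K s) (hm r K s) (Λ r K s) (hΛbox r K s) (hΛcomb r K s) (hcov r K s) (e r K s) hS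
      hS8 hSπ (hσ r K s) (hrad r K s) (hPu r K s) (hPubox r K s) (Pw r K s) (hβ r _) (hε r _) (hη r _) hδ0 hδ1 (hρ0 r _)
      (hρ r _) (hSM r K s) (hSMσ r K s)

/-- **… AT A DISPLAYED LEVEL MAJORANT** `D r (lvl r K s)` (file 2's `hDslot` row; END-I's `D ≤ D̄` takes it from there): the
written-out constant `≤ D r (lvl r K s)` is ONE displayed arithmetic binder `hD₀`. [folklore] -/
theorem hac_gibbs_of_face_le
    (P : Bool → ℕ → σ → Params) (jl lvl : Bool → ℕ → σ → ℕ) [∀ r K s, DecidableEq (PBond (P r K s) (jl r K s))]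
    {ε η ρ β : Bool → ℕ → ℝ} (hη : ∀ r j, 0 < η r j) (hε : ∀ r a, 0 < ε r a) (hρ0 : ∀ r j, 0 ≤ ρ r j)
    (lo hi : ∀ r K s, Fin (P r K s).d → ℤ) {mb : Bool → ℕ → σ → ℕ}
    (hN : ∀ r K s κ, hi r K s κ - lo r K s κ < (P r K s).sitesPerDir (jl r K s))
    (hm : ∀ r K s κ, hi r K s κ ≤ lo r K s κ + mb r K s)
    (Λ : ∀ r K s, Finset (PBond (P r K s) (jl r K s)))
    (hΛbox : ∀ r K s, ∀ b ∈ Λ r K s, b ∈ boxBonds (lo r K s) (hi r K s))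
    (hΛcomb : ∀ r K s, Disjoint (Λ r K s) (combBonds (lo r K s) (hi r K s)))
    (hcov : ∀ r K s, ∀ b ∈ boxBonds (lo r K s) (hi r K s), b ∉ Λ r K s →
      b ∈ (combBonds (lo r K s) (hi r K s) : Finset (PBond (P r K s) (jl r K s))))
    {m₀ : Bool → ℕ → σ → ℕ} (e : ∀ r K s, ↥(Λ r K s) × Fin 3 ≃ Fin (m₀ r K s))
    {S : ℝ} (hS : 0 < S) (hS8 : S ≤ 1 / 8) (hSπ : 3 * S ^ 2 < Real.pi ^ 2)
    {σc : Bool → ℕ → σ → ℝ} (hσ : ∀ r K s, 0 < σc r K s)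
    (hrad : ∀ r K s, (((P r K s).d - 1 : ℕ) : ℝ) * mb r K s * σc r K s ≤ 2 * S / Real.pi)
    {Pu : ∀ r K s, Finset (Plaq (P r K s) (jl r K s))} (hPu : ∀ r K s, (Pu r K s).Nonempty)
    (hPubox : ∀ r K s, ∀ p ∈ Pu r K s, p ∈ boxPlaqs (lo r K s) (hi r K s))
    (Pw : ∀ r K s, Finset (Plaq (P r K s) (jl r K s))) {δ : ℝ} (hδ0 : 0 ≤ δ) (hδ1 : δ < 1)
    (hρ : ∀ r j, ρ r j ≤ (1 - δ) / 2) (hβ : ∀ r j, 0 ≤ β r j)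
    (hSM : ∀ r K s, 4 * (8 * S) ^ 2 * Real.exp (2 * (8 * S)) ≤ δ * (ε r (K - lvl r K s) * η r (jl r K s) ^ 2))
    (hSMσ : ∀ r K s, 4 * (8 * S) ^ 2 * Real.exp (2 * (8 * S)) ≤ δ * σc r K s)
    {D : Bool → ℕ → ℝ}
    (hD₀ : ∀ r K s, 2 * ((m₀ r K s : ℝ) + β r (jl r K s) * ∑ _p ∈ Pw r K s, (8 * S) * (8 + 4 * (8 * S))) / (1 - δ) ≤
      D r (lvl r K s)) :
    ∀ (r : Bool) (K : ℕ) (t : ℝ) (s : σ),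
      SlotAntiConcentration
        ((fieldMeasure (P r K s) (jl r K s) SU2).withDensity
          (giF (lo r K s) (hi r K s) (σc r K s) (β r (jl r K s)) (Pw r K s)))
        (fun U => wilsonU (hPu r K s) U / η r (jl r K s) ^ 2) (ε r (K - lvl r K s)) (ρ r (lvl r K s)) (D r (lvl r K s)) :=
  fun r K t s => slotAntiConcentration_mono (hρ0 r _) (hD₀ r K s)
    (hac_gibbs_of_face P jl lvl hη hε hρ0 lo hi hN hm Λ hΛbox hΛcomb hcov e hS hS8 hSπ hσ hrad hPu hPubox Pw hδ0 hδ1 hρ hβ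
      hSM hSMσ r K t s)

/-- **… FOR IDENTIFIED FAMILIES ON THE GIBBS SLOTS** (guarded form, for a consumer keeping ONE density family `F r K t s`
and ONE variable family `u r K t s` over all live slots `S₀ r K ∪ S₁ r K`): on the Gibbs slots the density IS the Gibbs
face and the variable IS the Wilson classifier — the [dict] identification at lattice level 0, displayed as the two
pointwise hypotheses `hF₀`, `hu₀` (B14 (2.17)∕(2.18) at `k = 0` locate the SHAPE; nothing asserted) — and the binder
follows at the level majorant for every `s ∈ S₀ r K`. [folklore] -/
theorem hac_gibbs_of_identified
    (P : Bool → ℕ → σ → Params) (jl lvl : Bool → ℕ → σ → ℕ) [∀ r K s, DecidableEq (PBond (P r K s) (jl r K s))]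
    {ε η ρ β : Bool → ℕ → ℝ} (hη : ∀ r j, 0 < η r j) (hε : ∀ r a, 0 < ε r a) (hρ0 : ∀ r j, 0 ≤ ρ r j)
    (lo hi : ∀ r K s, Fin (P r K s).d → ℤ) {mb : Bool → ℕ → σ → ℕ}
    (hN : ∀ r K s κ, hi r K s κ - lo r K s κ < (P r K s).sitesPerDir (jl r K s))
    (hm : ∀ r K s κ, hi r K s κ ≤ lo r K s κ + mb r K s)
    (Λ : ∀ r K s, Finset (PBond (P r K s) (jl r K s)))
    (hΛbox : ∀ r K s, ∀ b ∈ Λ r K s, b ∈ boxBonds (lo r K s) (hi r K s))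
    (hΛcomb : ∀ r K s, Disjoint (Λ r K s) (combBonds (lo r K s) (hi r K s)))
    (hcov : ∀ r K s, ∀ b ∈ boxBonds (lo r K s) (hi r K s), b ∉ Λ r K s →
      b ∈ (combBonds (lo r K s) (hi r K s) : Finset (PBond (P r K s) (jl r K s))))
    {m₀ : Bool → ℕ → σ → ℕ} (e : ∀ r K s, ↥(Λ r K s) × Fin 3 ≃ Fin (m₀ r K s))
    {S : ℝ} (hS : 0 < S) (hS8 : S ≤ 1 / 8) (hSπ : 3 * S ^ 2 < Real.pi ^ 2)
    {σc : Bool → ℕ → σ → ℝ} (hσ : ∀ r K s, 0 < σc r K s)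
    (hrad : ∀ r K s, (((P r K s).d - 1 : ℕ) : ℝ) * mb r K s * σc r K s ≤ 2 * S / Real.pi)
    {Pu : ∀ r K s, Finset (Plaq (P r K s) (jl r K s))} (hPu : ∀ r K s, (Pu r K s).Nonempty)
    (hPubox : ∀ r K s, ∀ p ∈ Pu r K s, p ∈ boxPlaqs (lo r K s) (hi r K s))
    (Pw : ∀ r K s, Finset (Plaq (P r K s) (jl r K s))) {δ : ℝ} (hδ0 : 0 ≤ δ) (hδ1 : δ < 1)
    (hρ : ∀ r j, ρ r j ≤ (1 - δ) / 2) (hβ : ∀ r j, 0 ≤ β r j)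
    (hSM : ∀ r K s, 4 * (8 * S) ^ 2 * Real.exp (2 * (8 * S)) ≤ δ * (ε r (K - lvl r K s) * η r (jl r K s) ^ 2))
    (hSMσ : ∀ r K s, 4 * (8 * S) ^ 2 * Real.exp (2 * (8 * S)) ≤ δ * σc r K s)
    {D : Bool → ℕ → ℝ}
    (hD₀ : ∀ r K s, 2 * ((m₀ r K s : ℝ) + β r (jl r K s) * ∑ _p ∈ Pw r K s, (8 * S) * (8 + 4 * (8 * S))) / (1 - δ) ≤
      D r (lvl r K s))
    (S₀ : Bool → ℕ → Finset σ) (F : ∀ r K (t : ℝ) s, GaugeField (P r K s) (jl r K s) SU2 → ℝ≥0∞)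
    (u : ∀ r K (t : ℝ) s, GaugeField (P r K s) (jl r K s) SU2 → ℝ)
    (hF₀ : ∀ r K t, ∀ s ∈ S₀ r K, F r K t s = giF (lo r K s) (hi r K s) (σc r K s) (β r (jl r K s)) (Pw r K s))
    (hu₀ : ∀ r K t, ∀ s ∈ S₀ r K, u r K t s = wilsonU (hPu r K s)) :
    ∀ (r : Bool) (K : ℕ) (t : ℝ), ∀ s ∈ S₀ r K,
      SlotAntiConcentration ((fieldMeasure (P r K s) (jl r K s) SU2).withDensity (F r K t s))
        (fun U => u r K t s U / η r (jl r K s) ^ 2) (ε r (K - lvl r K s)) (ρ r (lvl r K s)) (D r (lvl r K s)) := by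
  intro r K t s hs
  rw [hF₀ r K t s hs, hu₀ r K t s hs]
  exact hac_gibbs_of_face_le P jl lvl hη hε hρ0 lo hi hN hm Λ hΛbox hΛcomb hcov e hS hS8 hSπ hσ hrad hPu hPubox Pw hδ0 hδ1
    hρ hβ hSM hSMσ hD₀ r K t s

end Family

/-! ## §3 The unit change fires on S1's conclusion shape at any scale (consistency); (x1) by pointer -/

/-- CONSISTENCY ∕ NOTHING IS LOST: at scale `η` the fine-currency face (S1 at `θ = εθ·η²`) and the threshold-units face of
§1 are the SAME statement (S90 `slotAntiConcentration_fine_iff`), for an arbitrary measure and variable — the Gibbs slots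
enter END-I exactly as the background-mediated ones do (file 1 applies the same unit change to S80 f3). [folklore] -/
example {Ω : Type*} [MeasurableSpace Ω] {μ : Measure Ω} {u : Ω → ℝ} {εθ η ρ D : ℝ} (hη : 0 < η)
    (h : SlotAntiConcentration μ u (εθ * η ^ 2) ρ D) :
    SlotAntiConcentration μ (fun x => u x / η ^ 2) εθ ρ D :=
  (slotAntiConcentration_fine_iff hη).1 h

/-- … and at the UNIT scale `η = 1` (lattice level 0 of the unit lattice) the unit change is the identity on the
threshold: `εθ·1² = εθ`. [folklore] -/
example {Ω : Type*} [MeasurableSpace Ω] {μ : Measure Ω} {u : Ω → ℝ} {εθ ρ D : ℝ}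
    (h : SlotAntiConcentration μ u εθ ρ D) :
    SlotAntiConcentration μ (fun x => u x / (1 : ℝ) ^ 2) εθ ρ D := by
  simpa only [one_pow, div_one] using h

end Summit.QuantumFields.BalabanUV.T4Continuum.ShellMeasureLiveEndOneCallGibbs

end
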